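import Summits.BirchSwinnertonDyer.BirchSwinnertonDyer.Theorems.ManinLocalTwoThreeManinPrimeToAdditiveFiveLeLedgerImcLaws
import Summits.BirchSwinnertonDyer.BirchSwinnertonDyer.Theorems.ManinLocalTwoThreeManinPrimeToAdditiveFiveLeAnchorRaynaudRowsOfTwistFamily
import HarnessLib

/-!
# Route `ManinLocalTwoThree`, residual crux C5 `ManinPrimeToAdditiveFiveLe`
# (stmt-BirchSwinnertonDyer-22969), line `upper_anchor`: **after gen 4 of the width seat the line has NO private
# open statement — C5 BY NAME from eight printed facts, three registered items of two sibling routes (KP57 =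
# stmt-23810, K15b = stmt-27071, OrdinaryCorner = stmt-27552) and two registered conjectures of the cell (E-imc-5 at
# 5, 7; E-imc-9 at 13)**

Width seat bsd-line-ml23-c5-p1-w2 (gen 4), piece υ5 (HOME STATUS 2026-08-28), sequel of υ (p626338), υ2 (p626766),
υ3 (p627384), υ4 (p627706). Skeleton v8 of the line (`Cruxes/ManinPrimeToAdditiveFiveLe/Lines/upper_anchor.lean`,
sha16 f41b6313bdbd3fbd) had three stubs carrying open mathematics: the ANCHOR `stub_red57unstarredOffIIAtFive`
(Manin for unstarred `W[p]`-reducible optimal curves on five Kodaira cells at 5, 7), law (U) and the degree law at 13.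
υ/υ2 identified (U) and the degree law with the imc cell's conjectures E-imc-5 / E-imc-9; υ4 handed the anchor's two
Raynaud rows to K15b (stmt-27071). Here the anchor's REMAINING rows — (5; III), (7; II), (7; IV): tame index
`e = p − 1` exactly, potentially ORDINARY — are handed, again BY NAME, to the TwistFamilyManinDescent route's declared
residual `OrdinaryCornerManinResidual` (stmt-BirchSwinnertonDyer-27552: «`p ∤ c` for the lattice-optimal curve on the
reducible additive rows with `e = p − 1`, `p ∈ {5,7}`, `W ⊗ p*` additive» — a STRONGER statement: no `p ∣ deg`,
`N > 5·10⁵`, `Iₙ*` or unstarred binder), so that: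

* `red57ss_of_ssUnstarredStrong`, `red7ordIV_of_ordinaryCorner`, `red57corner_of_ordinaryCorner` — **the three
  anchor stubs of the lead's skeleton v9 (`stub_red57ss`, `stub_red7ordIV`, `stub_red57corner`, VERBATIM) ⟸ K15b
  (27071) resp. OrdinaryCorner (27552)**, i.e. v9's whole `W[p]`-reducible anchor at 5, 7 is BY NAME.
* `red57unstarredOffIIAtFive_of_ordinaryCorner_of_ssUnstarredStrong` — **the ANCHOR stub VERBATIM ⟸ stmt-27552 ∧
  stmt-27071** (row dispatch: (5; IV), (7; III) → K15b; (5; III), (7; II), (7; IV) → OrdinaryCorner; the twist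
  `W ⊗ p*` is additive at `p` by the line's twist-minimality clause, υ4 §1).
* `maninPrimeToAdditiveFiveLe_of_prints_of_siblingItems_of_imcLaws` — **C5 BY NAME ⟸ {F″, ČNS, Cremona ≤ 5·10⁵,
  EdK, EdG, MazurJ, D–D 2015, GK 2017} ∧ KP57 (23810) ∧ K15b (27071) ∧ OrdinaryCorner (27552) ∧
  `OptimalUnstarredAcrossIsogeny 5` ∧ `OptimalUnstarredAcrossIsogeny 7` (E-imc-5) ∧ `OrdinaryRamifiedTwistLaw 13`
  (E-imc-9)** — υ3's ledger fed with the dispatch.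

So every open input of the `upper_anchor` line is now a registered ledger object with its own owner and refuter
record; the line itself is closed MODULO them (skeleton v8's composition, kernel-checked). HONEST STATUS:
conditional-result helpers (`--supports … --as helper`): the three sibling items and the two imc conjectures are OPEN
(beyond print at `p ≤ 7` / Stevens–Stein–Watkins-type), the eight facts are cite-only. Nothing here proves BSD,
Manin's conjecture, any of those items, or C5.

References: [EdixhovenManin1991] Thm. 3, Prop. 7, §4; [CesnaviciusNeururerSaha2023] Thm. 1.2; [Kato2004Asterisque]
(8.1.3), Thm. 9.7; [Mazur1978] Thm. 1; [DokchitserDokchitser2015LocalInvariants] Thm. 5.1 (1), Thm. 7 / Cor. 8;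
[GealyKlagsbrun2017] Thm. 1; [KostersPannekoek2017] Cor. 2; cell bsd-f2-manin MEMO-imc.md §3, §10; route
TwistFamilyManinDescent items K15b / OrdinaryCornerManinResidual (bsd-idea-3).
-/

set_option autoImplicit false
-- the Theorems namespace of this sub repeats the summit name by design (D-0017 nested layout)
set_option linter.dupNamespace false

noncomputable section

open scoped Classical NumberField

namespace Summit.BirchSwinnertonDyer.BirchSwinnertonDyer.Theorems

open WeierstrassCurve IsDedekindDomain NumberField
  Literature.NumberTheory.EllipticCurves Literature.NumberTheory.EllipticCurves.ModularForms
  Summit.BirchSwinnertonDyer.Rank1Residual.ManinAdditive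
  Summit.BirchSwinnertonDyer.Rank1Residual.Additive
  Summit.BirchSwinnertonDyer.BirchSwinnertonDyer.Theses.EdixhovenFibreFiveSeven
  Summit.BirchSwinnertonDyer.BirchSwinnertonDyer.Theses.TwistFamilyManinDescent

/-! ## §0 The three anchor stubs of skeleton v9 (lead gen 5, sha 15e8acc5ed72) BY NAME from the sibling route -/

/-- **`stub_red57ss` (skeleton v9, VERBATIM: the Raynaud rows (5; IV), (7; III)) ⟸ K15b
`TwistFamilyManinDescent.SupersingularUnstarredStrongManinUnit` (stmt-BirchSwinnertonDyer-27071).** Level = conductor;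
`W ⊗ p*` additive at `p` by the twist-minimality clause (`quadraticTwist_pStar_additive_of_twistMinimal`); the row
clause is passed through (`padicValInt 5`/`padicValInt 7` after `p = 5`/`p = 7`). Conditional result (open item of a
sibling route); closes nothing. [cite: EdixhovenManin1991, Prop. 7 and Thm. 3] -/
theorem red57ss_of_ssUnstarredStrong (hK : SupersingularUnstarredStrongManinUnit) :
    mazur_not_dvd_maninConstant_of_odd → abbesUllmo_not_dvd_maninConstant_of_not_dvd_level →
    cesnavicius_not_two_dvd_maninConstant_of_two_dvd_level → exists_isNewformOf →
    ∀ (W : WeierstrassCurve ℚ) [W.IsElliptic] [W.IsGloballyMinimal] [NeZero (W.conductorNorm ℤ)]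
      (D : ModularParametrizationData W (W.conductorNorm ℤ)),
      IsLatticeOptimal D → ∀ (p : ℕ) (hp : p.Prime), (p = 5 ∨ p = 7) → p ^ 2 ∣ W.conductorNorm ℤ →
      ¬ (∃ (W' : WeierstrassCurve ℚ) (q : ℕ), W'.IsElliptic ∧ W'.IsGloballyMinimal ∧ q.Prime ∧
          q ≠ 2 ∧ q ^ 2 ∣ W.conductorNorm ℤ ∧
          IsIsogenous W (W'.quadraticTwist (((-1 : ℤ) ^ (q / 2) * q : ℤ) : ℚ)) ∧
          ¬ q ^ 2 ∣ W'.conductorNorm ℤ) →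
      ¬ (∃ (W' : WeierstrassCurve ℚ) (d : ℤ), W'.IsElliptic ∧ W'.IsGloballyMinimal ∧
          (d = -1 ∨ d = 2 ∨ d = -2) ∧ 2 ^ 2 ∣ W.conductorNorm ℤ ∧
          IsIsogenous W (W'.quadraticTwist (d : ℚ)) ∧ ¬ 2 ^ 2 ∣ W'.conductorNorm ℤ) →
      ¬ W.HasIrreducibleModPGaloisRep p →
      500000 < W.conductorNorm ℤ →
      p ∣ D.modularDegree →
      (∀ n : ℕ, W.kodairaSymbolAt ((Rat.HeightOneSpectrum.primesEquiv (R := ℤ)).symm ⟨p, hp⟩) ≠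
        .Istar n) →
      padicValInt p W.minimalDiscriminantInt ≤ 4 →
      (p = 5 → padicValInt p W.minimalDiscriminantInt ≠ 2) →
      ((p = 5 ∧ padicValInt p W.minimalDiscriminantInt = 4) ∨
        (p = 7 ∧ padicValInt p W.minimalDiscriminantInt = 3)) →
      ¬ (p : ℤ) ∣ D.maninConstant := by
  intro hM hAU hC hnf W _ _ _ D hD p hp h57 hpN hodd _hdy hred _hN _hdeg _hI _hv _hII5 hrow
  have hp2 : p ≠ 2 := by rcases h57 with rfl | rfl <;> norm_num
  have htw := quadraticTwist_pStar_additive_of_twistMinimal W hp hp2 hpN hodd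
  refine hK hM hAU hC hnf W D p hp ?_ hpN hred htw hD
  rcases hrow with ⟨rfl, h⟩ | ⟨rfl, h⟩
  · exact Or.inl ⟨rfl, h⟩
  · exact Or.inr ⟨rfl, h⟩

/-- **`stub_red7ordIV` (skeleton v9, VERBATIM: the row (7; IV), potentially ordinary, Edixhoven case 1) ⟸
`TwistFamilyManinDescent.OrdinaryCornerManinResidual` (stmt-BirchSwinnertonDyer-27552)** — a STRONGER statement of the
sibling route (rows `e = p − 1`, no `p ∣ deg` / `N > 5·10⁵` / `Iₙ*` binder). Conditional result; closes nothing.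
[cite: EdixhovenManin1991, Thm. 3 and §4] -/
theorem red7ordIV_of_ordinaryCorner (hOC : OrdinaryCornerManinResidual) :
    mazur_not_dvd_maninConstant_of_odd → abbesUllmo_not_dvd_maninConstant_of_not_dvd_level →
    cesnavicius_not_two_dvd_maninConstant_of_two_dvd_level → exists_isNewformOf →
    ∀ (W : WeierstrassCurve ℚ) [W.IsElliptic] [W.IsGloballyMinimal] [NeZero (W.conductorNorm ℤ)]
      (D : ModularParametrizationData W (W.conductorNorm ℤ)),
      IsLatticeOptimal D → ∀ (p : ℕ) (hp : p.Prime), (p = 5 ∨ p = 7) → p ^ 2 ∣ W.conductorNorm ℤ →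
      ¬ (∃ (W' : WeierstrassCurve ℚ) (q : ℕ), W'.IsElliptic ∧ W'.IsGloballyMinimal ∧ q.Prime ∧
          q ≠ 2 ∧ q ^ 2 ∣ W.conductorNorm ℤ ∧
          IsIsogenous W (W'.quadraticTwist (((-1 : ℤ) ^ (q / 2) * q : ℤ) : ℚ)) ∧
          ¬ q ^ 2 ∣ W'.conductorNorm ℤ) →
      ¬ (∃ (W' : WeierstrassCurve ℚ) (d : ℤ), W'.IsElliptic ∧ W'.IsGloballyMinimal ∧
          (d = -1 ∨ d = 2 ∨ d = -2) ∧ 2 ^ 2 ∣ W.conductorNorm ℤ ∧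
          IsIsogenous W (W'.quadraticTwist (d : ℚ)) ∧ ¬ 2 ^ 2 ∣ W'.conductorNorm ℤ) →
      ¬ W.HasIrreducibleModPGaloisRep p →
      500000 < W.conductorNorm ℤ →
      p ∣ D.modularDegree →
      (∀ n : ℕ, W.kodairaSymbolAt ((Rat.HeightOneSpectrum.primesEquiv (R := ℤ)).symm ⟨p, hp⟩) ≠
        .Istar n) →
      padicValInt p W.minimalDiscriminantInt ≤ 4 →
      (p = 5 → padicValInt p W.minimalDiscriminantInt ≠ 2) →
      p = 7 → padicValInt p W.minimalDiscriminantInt = 4 →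
      ¬ (p : ℤ) ∣ D.maninConstant := by
  intro hM hAU hC hnf W _ _ _ D hD p hp h57 hpN hodd _hdy hred _hN _hdeg _hI _hv _hII5 h7 h4
  subst h7
  have htw := quadraticTwist_pStar_additive_of_twistMinimal W hp (by norm_num) hpN hodd
  refine hOC hM hAU hC hnf W D 7 hp (Or.inr rfl) ?_ ?_ hpN hred htw hD
  · rintro (⟨h5, -⟩ | ⟨-, h⟩)
    · omega
    · simp only [Finset.mem_insert, Finset.mem_singleton] at h
      omega
  · rintro ⟨h5, -⟩
    omega

/-- **`stub_red57corner` (skeleton v9, VERBATIM: the rows (5; III), (7; II), `e = p − 1`) ⟸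
`TwistFamilyManinDescent.OrdinaryCornerManinResidual` (stmt-BirchSwinnertonDyer-27552).** Conditional result; closes
nothing. [cite: EdixhovenManin1991, Thm. 3 and §4] -/
theorem red57corner_of_ordinaryCorner (hOC : OrdinaryCornerManinResidual) :
    mazur_not_dvd_maninConstant_of_odd → abbesUllmo_not_dvd_maninConstant_of_not_dvd_level →
    cesnavicius_not_two_dvd_maninConstant_of_two_dvd_level → exists_isNewformOf →
    ∀ (W : WeierstrassCurve ℚ) [W.IsElliptic] [W.IsGloballyMinimal] [NeZero (W.conductorNorm ℤ)]
      (D : ModularParametrizationData W (W.conductorNorm ℤ)),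
      IsLatticeOptimal D → ∀ (p : ℕ) (hp : p.Prime), (p = 5 ∨ p = 7) → p ^ 2 ∣ W.conductorNorm ℤ →
      ¬ (∃ (W' : WeierstrassCurve ℚ) (q : ℕ), W'.IsElliptic ∧ W'.IsGloballyMinimal ∧ q.Prime ∧
          q ≠ 2 ∧ q ^ 2 ∣ W.conductorNorm ℤ ∧
          IsIsogenous W (W'.quadraticTwist (((-1 : ℤ) ^ (q / 2) * q : ℤ) : ℚ)) ∧
          ¬ q ^ 2 ∣ W'.conductorNorm ℤ) →
      ¬ (∃ (W' : WeierstrassCurve ℚ) (d : ℤ), W'.IsElliptic ∧ W'.IsGloballyMinimal ∧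
          (d = -1 ∨ d = 2 ∨ d = -2) ∧ 2 ^ 2 ∣ W.conductorNorm ℤ ∧
          IsIsogenous W (W'.quadraticTwist (d : ℚ)) ∧ ¬ 2 ^ 2 ∣ W'.conductorNorm ℤ) →
      ¬ W.HasIrreducibleModPGaloisRep p →
      500000 < W.conductorNorm ℤ →
      p ∣ D.modularDegree →
      (∀ n : ℕ, W.kodairaSymbolAt ((Rat.HeightOneSpectrum.primesEquiv (R := ℤ)).symm ⟨p, hp⟩) ≠
        .Istar n) →
      padicValInt p W.minimalDiscriminantInt ≤ 4 →
      (p = 5 → padicValInt p W.minimalDiscriminantInt ≠ 2) →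
      ((p = 5 ∧ padicValInt p W.minimalDiscriminantInt = 3) ∨
        (p = 7 ∧ padicValInt p W.minimalDiscriminantInt = 2)) →
      ¬ (p : ℤ) ∣ D.maninConstant := by
  intro hM hAU hC hnf W _ _ _ D hD p hp h57 hpN hodd _hdy hred _hN _hdeg _hI _hv _hII5 hrow
  have hp2 : p ≠ 2 := by rcases h57 with rfl | rfl <;> norm_num
  have htw := quadraticTwist_pStar_additive_of_twistMinimal W hp hp2 hpN hodd
  refine hOC hM hAU hC hnf W D p hp h57 ?_ ?_ hpN hred htw hD
  · rintro (⟨rfl, h⟩ | ⟨rfl, h⟩)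
    · simp only [Finset.mem_insert, Finset.mem_singleton] at h
      rcases hrow with ⟨-, h'⟩ | ⟨h', -⟩ <;> omega
    · simp only [Finset.mem_insert, Finset.mem_singleton] at h
      rcases hrow with ⟨h', -⟩ | ⟨-, h'⟩ <;> omega
  · rintro ⟨rfl, h⟩
    simp only [Finset.mem_insert, Finset.mem_singleton] at h
    rcases hrow with ⟨-, h'⟩ | ⟨h', -⟩ <;> omega

/-! ## §1 The ANCHOR stub from the two sibling items -/

/-- **`stub_red57unstarredOffIIAtFive` (skeleton v8 of line `upper_anchor`, VERBATIM) ⟸ OrdinaryCorner (stmt-27552)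
∧ K15b (stmt-27071).** Row dispatch on `(p, ord_p Δ_min)`: the Raynaud rows (5; 4), (7; 3) go to K15b
`SupersingularUnstarredStrongManinUnit`; the remaining unstarred rows (5; 3), (7; 2), (7; 4) satisfy the cell clauses
of `OrdinaryCornerManinResidual` (`ord₅ ∉ {4,8}`, `ord₅ ∉ {2,10}` by the stub's own `≠ 2` binder, `ord₇ ∉ {3,9}`);
in both cases the level is the conductor and `W ⊗ p*` is additive at `p` by the twist-minimality clause
(`quadraticTwist_pStar_additive_of_twistMinimal`). Conditional result (two open items of a sibling route); closes
nothing. [cite: EdixhovenManin1991, Thm. 3 and Prop. 7] [cite: SilvermanATAEC1994, IV Table 4.1] -/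
theorem red57unstarredOffIIAtFive_of_ordinaryCorner_of_ssUnstarredStrong
    (hOC : OrdinaryCornerManinResidual) (hK : SupersingularUnstarredStrongManinUnit) :
    mazur_not_dvd_maninConstant_of_odd → abbesUllmo_not_dvd_maninConstant_of_not_dvd_level →
    cesnavicius_not_two_dvd_maninConstant_of_two_dvd_level → exists_isNewformOf →
    ∀ (W : WeierstrassCurve ℚ) [W.IsElliptic] [W.IsGloballyMinimal] [NeZero (W.conductorNorm ℤ)]
      (D : ModularParametrizationData W (W.conductorNorm ℤ)),
      IsLatticeOptimal D → ∀ (p : ℕ) (hp : p.Prime), (p = 5 ∨ p = 7) → p ^ 2 ∣ W.conductorNorm ℤ →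
      ¬ (∃ (W' : WeierstrassCurve ℚ) (q : ℕ), W'.IsElliptic ∧ W'.IsGloballyMinimal ∧ q.Prime ∧
          q ≠ 2 ∧ q ^ 2 ∣ W.conductorNorm ℤ ∧
          IsIsogenous W (W'.quadraticTwist (((-1 : ℤ) ^ (q / 2) * q : ℤ) : ℚ)) ∧
          ¬ q ^ 2 ∣ W'.conductorNorm ℤ) →
      ¬ (∃ (W' : WeierstrassCurve ℚ) (d : ℤ), W'.IsElliptic ∧ W'.IsGloballyMinimal ∧
          (d = -1 ∨ d = 2 ∨ d = -2) ∧ 2 ^ 2 ∣ W.conductorNorm ℤ ∧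
          IsIsogenous W (W'.quadraticTwist (d : ℚ)) ∧ ¬ 2 ^ 2 ∣ W'.conductorNorm ℤ) →
      ¬ W.HasIrreducibleModPGaloisRep p →
      500000 < W.conductorNorm ℤ →
      p ∣ D.modularDegree →
      (∀ n : ℕ, W.kodairaSymbolAt ((Rat.HeightOneSpectrum.primesEquiv (R := ℤ)).symm ⟨p, hp⟩) ≠
        .Istar n) →
      padicValInt p W.minimalDiscriminantInt ≤ 4 →
      (p = 5 → padicValInt p W.minimalDiscriminantInt ≠ 2) →
      ¬ (p : ℤ) ∣ D.maninConstant := by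
  refine red57unstarredOffIIAtFive_of_offRaynaud_of_ssUnstarredStrong hK ?_
  intro hM hAU hC hnf W _ _ _ D hD p hp h57 hpN hodd _hdy hred _hN _hdeg _hI hv hII5 hIV5 hIII7
  have hp2 : p ≠ 2 := by rcases h57 with rfl | rfl <;> norm_num
  have htw := quadraticTwist_pStar_additive_of_twistMinimal W hp hp2 hpN hodd
  refine hOC hM hAU hC hnf W D p hp h57 ?_ ?_ hpN hred htw hD
  · rintro (⟨rfl, h⟩ | ⟨rfl, h⟩)
    · simp only [Finset.mem_insert, Finset.mem_singleton] at h
      rcases h with h | h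
      · exact hIV5 rfl h
      · omega
    · simp only [Finset.mem_insert, Finset.mem_singleton] at h
      rcases h with h | h
      · exact hIII7 rfl h
      · omega
  · rintro ⟨rfl, h⟩
    simp only [Finset.mem_insert, Finset.mem_singleton] at h
    rcases h with h | h
    · exact hII5 rfl h
    · omega

/-! ## §2 The by-name ledger of the line after gen 4 -/

/-- **C5 BY NAME ⟸ eight cite-only printed facts ∧ KP57 (stmt-23810) ∧ K15b (stmt-27071) ∧ OrdinaryCorner
(stmt-27552) ∧ E-imc-5 at 5 and 7 ∧ E-imc-9 at 13.** υ3's ledger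
`maninPrimeToAdditiveFiveLe_of_prints_of_kp57_of_anchor_of_imcLaws` (p627384) with its ANCHOR hypothesis discharged by
§1. Every non-printed input is a registered ledger item or conjecture of the cell; the `upper_anchor` line keeps no
private open statement. Conditional result; closes nothing.
[cite: EdixhovenManin1991, Thm. 3] [cite: CesnaviciusNeururerSaha2023, Thm. 1.2] [cite: GealyKlagsbrun2017, Thm. 1]
[cite: DokchitserDokchitser2015LocalInvariants, Thm. 5.1 (1)] [cite: KostersPannekoek2017, Cor. 2] -/
theorem maninPrimeToAdditiveFiveLe_of_prints_of_siblingItems_of_imcLaws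
    (hK57 : kato_neron_isIntegral_twistedSymbolSum_of_additive_five_le)
    (hCNS : cesnaviciusNeururerSaha_padicVal_maninConstant_le_modularDegree)
    (h500k : cremona_abs_maninConstant_eq_one_of_level_le_500000)
    (hEdK : edixhoven_not_dvd_maninConstant_of_kodairaSymbol_ne)
    (hEdG : edixhoven_not_dvd_maninConstant_of_not_potentiallyGoodOrdinary)
    (hJ : mazur_j_mem_of_not_hasIrreducibleModPGaloisRep_of_eleven_le)
    (hDD : dokchitser_padicValInt_minimalDiscriminantInt_eq_of_isogeny_of_potentiallyGoodOrdinary)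
    (hGK : gealyKlagsbrun2017_neronScalar_of_additive_potSupersingular)
    (hKP57 : KPResidueManinUnitFiveSeven)
    (hK15b : SupersingularUnstarredStrongManinUnit)
    (hOC : OrdinaryCornerManinResidual)
    (hE5 : OptimalUnstarredAcrossIsogeny 5) (hE7 : OptimalUnstarredAcrossIsogeny 7)
    (hO13 : OrdinaryRamifiedTwistLaw 13) :
    Summit.BirchSwinnertonDyer.BirchSwinnertonDyer.Theses.ManinLocalTwoThree.ManinPrimeToAdditiveFiveLe :=
  maninPrimeToAdditiveFiveLe_of_prints_of_kp57_of_anchor_of_imcLaws hK57 hCNS h500k hEdK hEdG hJ hDD hGK hKP57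
    (red57unstarredOffIIAtFive_of_ordinaryCorner_of_ssUnstarredStrong hOC hK15b) hE5 hE7 hO13

end Summit.BirchSwinnertonDyer.BirchSwinnertonDyer.Theorems

end
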